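import Literature.Analysis.FluidPDE.TypeIAncientMild
import Literature.Analysis.FluidPDE.SpaceTimeCalculus
import HarnessLib

/-!
# Route ClockStretchingLaw — crux `ClockCeiling`, line `registered`: the scale-invariant local
# energies pass to pointwise limits of Type-I ancient mild fields

Helper file for the lead's stub `stub_zoomCompactness` of the reshaped skeleton of crux
`ClockCeiling` (item stmt-NavierStokesRegularity-10570). The fifth clause of the route's Type-I
class bounds the scaled kinetic energy `A = r⁻¹ sup_t ∫_{B(x₀,r)} ‖u(t)‖²` and the scaled
dissipation `E = r⁻¹ ∫∫_{Q((x₀,t₀),r)} ‖∇u‖²` by `C` on every parabolic cylinder below `t = 0`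
(Albritton–Barker 2019, (1.5)–(1.10)). Along a sequence `wₙ → W` of Type-I ancient mild fields
converging pointwise together with their gradients, with a uniform scale-invariant gradient
bound `‖∇wₙ(t,x)‖ ≤ K(-t)⁻¹`, both bounds pass to the limit with the SAME constant:

* `energyA_of_limit` — dominated convergence on the ball (Type-I bound as majorant);
* `energyE_of_limit_neg` — cylinders with top `t₀ < 0`: dominated convergence in `x`, then in
  `t` (the gradient bound is uniform there);
* `energyE_of_limit_zero` — cylinders touching `t = 0`: the integral over `(-r², 0)` is the
  monotone limit of the integrals over `(-r², -r²/(n+2))`, each dominated by a cylinder with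
  negative top (or the Bochner integral vanishes if the integrand is not integrable);
* `localEnergy_of_limit` — the clause for `W` (registered sub-goal `zoomEnergy_of_limit`).

Also: pointwise convergence of continuous linear maps on `ℝ³` is operator-norm convergence
(`tendsto_clm_of_tendsto_apply`, via `Basis.opNorm_le`).

## References

* D. Albritton, T. Barker, arXiv:1811.00502, §1 (1.5)–(1.10) (the scaled energies).
* G. Koch, N. Nadirashvili, G. Seregin, V. Šverák, Acta Math. 203 (2009) = arXiv:0709.3599,
  Lemma 6.1, Prop. 4.1.
-/

set_option linter.dupNamespace false

noncomputable section

open Literature.Analysis.FluidPDE MeasureTheory Set Function Filter Topology Metric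
open scoped ENNReal NNReal

namespace Summit.NavierStokesRegularity.NavierStokesRegularity.Theorems

/-! ### Pointwise convergence of operators on `ℝ³` -/

section Operator

variable {F : Type*} [NormedAddCommGroup F] [NormedSpace ℝ F]

/-- **On a finite-dimensional domain, pointwise convergence of continuous linear maps is norm
convergence** (here for `ℝ³`, through the standard basis and `Basis.opNorm_le`). -/
theorem tendsto_clm_of_tendsto_apply {L : ℕ → (EuclideanSpace ℝ (Fin 3)) →L[ℝ] F}
    {L₀ : (EuclideanSpace ℝ (Fin 3)) →L[ℝ] F}
    (h : ∀ e, Tendsto (fun n => L n e) atTop (𝓝 (L₀ e))) : Tendsto L atTop (𝓝 L₀) := by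
  set v := (EuclideanSpace.basisFun (Fin 3) ℝ).toBasis with hv
  set c : ℝ := (Fintype.card (Fin 3) • ‖v.equivFunL.toContinuousLinearMap‖ : ℝ) with hc
  set M : ℕ → ℝ := fun n => ∑ i, ‖(L n - L₀) (v i)‖ with hM
  have hM0 : ∀ n, 0 ≤ M n := fun n => Finset.sum_nonneg fun i _ => norm_nonneg _
  have hMlim : Tendsto M atTop (𝓝 0) := by
    have h1 : ∀ i, Tendsto (fun n => ‖(L n - L₀) (v i)‖) atTop (𝓝 0) := fun i => by
      have h2 := (h (v i)).sub_const (L₀ (v i))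
      rw [sub_self] at h2
      simpa using h2.norm
    have h3 := tendsto_finsetSum (Finset.univ : Finset (Fin 3)) fun i _ => h1 i
    simpa [hM] using h3
  rw [tendsto_iff_norm_sub_tendsto_zero]
  have hbd : ∀ n, ‖L n - L₀‖ ≤ c * M n := fun n =>
    v.opNorm_le (hM0 n) fun i =>
      Finset.single_le_sum (f := fun j => ‖(L n - L₀) (v j)‖) (fun j _ => norm_nonneg _)
        (Finset.mem_univ i)
  have hc0 : Tendsto (fun n => c * M n) atTop (𝓝 0) := by
    simpa using hMlim.const_mul c
  exact squeeze_zero (fun n => norm_nonneg _) hbd hc0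

end Operator

/-! ### Energies of pointwise limits -/

section Energy

variable {C K : ℝ} {w : ℕ → ℝ → (EuclideanSpace ℝ (Fin 3)) → (EuclideanSpace ℝ (Fin 3))}
  {W : ℝ → (EuclideanSpace ℝ (Fin 3)) → (EuclideanSpace ℝ (Fin 3))}

/-- **The scaled kinetic energy passes to pointwise limits** (dominated convergence on the ball,
majorant `(C/√(-t))²`): if every `wₙ` has `r⁻¹∫_{B(x₀,r)}‖wₙ(t)‖² ≤ C` on all cylinders below
`t = 0` and `wₙ(t,x) → W(t,x)`, then so does `W`. -/
theorem energyA_of_limit (hw : ∀ n, IsTypeIAncientMild C (w n)) (hW : IsTypeIAncientMild C W)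
    (hpt : ∀ t < 0, ∀ x, Tendsto (fun n => w n t x) atTop (𝓝 (W t x)))
    (hA : ∀ n (x₀ : EuclideanSpace ℝ (Fin 3)) (t₀ r : ℝ), t₀ ≤ 0 → 0 < r →
      ∀ t, t₀ - r ^ 2 < t → t < t₀ → r⁻¹ * ∫ x in ball x₀ r, ‖w n t x‖ ^ 2 ≤ C)
    (x₀ : EuclideanSpace ℝ (Fin 3)) {t₀ r : ℝ} (ht₀ : t₀ ≤ 0) (hr : 0 < r)
    {t : ℝ} (h1 : t₀ - r ^ 2 < t) (h2 : t < t₀) :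
    r⁻¹ * ∫ x in ball x₀ r, ‖W t x‖ ^ 2 ≤ C := by
  have ht : t < 0 := h2.trans_le ht₀
  have hlim : Tendsto (fun n => ∫ x in ball x₀ r, ‖w n t x‖ ^ 2) atTop
      (𝓝 (∫ x in ball x₀ r, ‖W t x‖ ^ 2)) := by
    refine tendsto_integral_of_dominated_convergence (fun _ => (C / Real.sqrt (-t)) ^ 2)
      (fun n => (((hw n).continuous_slice ht).norm.pow 2).aestronglyMeasurable)
      (integrableOn_const (measure_ball_lt_top).ne) (fun n => Eventually.of_forall fun x => ?_)
      (Eventually.of_forall fun x => ((hpt t ht x).norm).pow 2)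
    rw [Real.norm_eq_abs, abs_of_nonneg (sq_nonneg _)]
    exact pow_le_pow_left₀ (norm_nonneg _) ((hw n).norm_le ht x) 2
  have hlim' := hlim.const_mul r⁻¹
  have _ := hW
  exact le_of_tendsto' hlim' fun n => hA n x₀ t₀ r ht₀ hr t h1 h2

/-- The constant in a scale-invariant gradient bound is nonnegative. -/
theorem nonneg_of_gradient_bound {V : ℝ → (EuclideanSpace ℝ (Fin 3)) → (EuclideanSpace ℝ (Fin 3))}
    (h1x : ∀ t < 0, ∀ x, ‖fderiv ℝ (V t) x‖ ≤ K * (-t) ^ (-(1 : ℝ))) : 0 ≤ K := by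
  have h := h1x (-1) (by norm_num) 0
  rw [neg_neg, Real.one_rpow, mul_one] at h
  exact (norm_nonneg _).trans h

/-- A scale-invariant gradient bound is uniform below a negative time: for `t ≤ b < 0`,
`K(-t)⁻¹ ≤ K(-b)⁻¹`. -/
theorem gradient_bound_mono (hK : 0 ≤ K) {t b : ℝ} (hb : b < 0) (htb : t ≤ b) :
    K * (-t) ^ (-(1 : ℝ)) ≤ K * (-b) ^ (-(1 : ℝ)) :=
  mul_le_mul_of_nonneg_left (Real.rpow_le_rpow_of_nonpos (by linarith) (by linarith) (by norm_num)) hK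

/-- **Continuity in time of the local enstrophy** `t ↦ ∫_{B(x₀,r)} ‖∇V(t)‖²` of a Type-I ancient
mild field with a scale-invariant gradient bound (dominated continuity: the gradient is jointly
continuous on the open slab and uniformly bounded near each negative time). -/
theorem continuousAt_enstrophy {V : ℝ → (EuclideanSpace ℝ (Fin 3)) → (EuclideanSpace ℝ (Fin 3))}
    (hV : IsTypeIAncientMild C V)
    (h1x : ∀ t < 0, ∀ x, ‖fderiv ℝ (V t) x‖ ≤ K * (-t) ^ (-(1 : ℝ)))
    (x₀ : EuclideanSpace ℝ (Fin 3)) (r : ℝ) {t : ℝ} (ht : t < 0) :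
    ContinuousAt (fun τ => ∫ x in ball x₀ r, ‖fderiv ℝ (V τ) x‖ ^ 2) t := by
  have hK : 0 ≤ K := nonneg_of_gradient_bound h1x
  have hsm : IsSmoothSpaceTimeOn (Iio 0) V := hV.contDiffOn
  have hjc : ContinuousOn (fun z : ℝ × (EuclideanSpace ℝ (Fin 3)) => fderiv ℝ (V z.1) z.2)
      (Iio 0 ×ˢ univ) := hsm.continuousOn_fderiv_slice (uniqueDiffOn_Iio 0)
  -- near `t`: `τ ∈ (2t, t/2)`
  have hnhds : Ioo (2 * t) (t / 2) ∈ 𝓝 t := Ioo_mem_nhds (by linarith) (by linarith)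
  set B : ℝ := (K * (-(t / 2)) ^ (-(1 : ℝ))) ^ 2 with hB
  refine continuousAt_of_dominated (bound := fun _ => B) ?_ ?_
    (integrableOn_const (measure_ball_lt_top).ne) ?_
  · filter_upwards [hnhds] with τ hτ
    have hτ0 : τ < 0 := by linarith [hτ.2]
    exact (((hV.contDiff_slice hτ0).continuous_fderiv (by simp)).norm.pow 2).aestronglyMeasurable
  · filter_upwards [hnhds] with τ hτ
    have hτ0 : τ < 0 := by linarith [hτ.2]
    refine Eventually.of_forall fun x => ?_
    rw [Real.norm_eq_abs, abs_of_nonneg (sq_nonneg _), hB]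
    exact pow_le_pow_left₀ (norm_nonneg _)
      ((h1x τ hτ0 x).trans (gradient_bound_mono hK (by linarith) hτ.2.le)) 2
  · refine Eventually.of_forall fun x => ?_
    have hι : ContinuousAt (fun τ : ℝ => ((τ, x) : ℝ × (EuclideanSpace ℝ (Fin 3)))) t := by fun_prop
    have hmem : Iio (0 : ℝ) ×ˢ (univ : Set (EuclideanSpace ℝ (Fin 3))) ∈ 𝓝 (t, x) :=
      (isOpen_Iio.prod isOpen_univ).mem_nhds (mk_mem_prod ht (mem_univ x))
    exact (((hjc.continuousAt hmem).comp_of_eq hι rfl).norm).pow 2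

/-- The local enstrophy of a Type-I ancient mild field with a scale-invariant gradient bound is
bounded by `B(-b)⁻² vol B(x₀,r)`-type constants below a negative time `b`: precisely
`∫_{B(x₀,r)} ‖∇V(t)‖² ≤ (K(-b)⁻¹)² · vol(B(x₀,r))` for `t ≤ b < 0`. -/
theorem enstrophy_le {V : ℝ → (EuclideanSpace ℝ (Fin 3)) → (EuclideanSpace ℝ (Fin 3))}
    (h1x : ∀ t < 0, ∀ x, ‖fderiv ℝ (V t) x‖ ≤ K * (-t) ^ (-(1 : ℝ)))
    (x₀ : EuclideanSpace ℝ (Fin 3)) (r : ℝ) {t b : ℝ} (hb : b < 0) (htb : t ≤ b) :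
    ‖∫ x in ball x₀ r, ‖fderiv ℝ (V t) x‖ ^ 2‖ ≤
      (K * (-b) ^ (-(1 : ℝ))) ^ 2 * (volume : Measure (EuclideanSpace ℝ (Fin 3))).real (ball x₀ r) := by
  have hK : 0 ≤ K := nonneg_of_gradient_bound h1x
  refine norm_setIntegral_le_of_norm_le_const measure_ball_lt_top fun x _ => ?_
  rw [Real.norm_eq_abs, abs_of_nonneg (sq_nonneg _)]
  exact pow_le_pow_left₀ (norm_nonneg _)
    ((h1x t (by linarith) x).trans (gradient_bound_mono hK hb htb)) 2

/-- **The scaled dissipation passes to pointwise limits on cylinders with negative top**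
(dominated convergence in `x`, then in `t`; the gradients converge pointwise as operators and
are uniformly bounded by `K(-t₀)⁻¹` on the cylinder). -/
theorem energyE_of_limit_neg (hw : ∀ n, IsTypeIAncientMild C (w n)) (hW : IsTypeIAncientMild C W)
    (hgrad : ∀ t < 0, ∀ x, Tendsto (fun n => fderiv ℝ (w n t) x) atTop (𝓝 (fderiv ℝ (W t) x)))
    (h1x : ∀ n, ∀ t < 0, ∀ x, ‖fderiv ℝ (w n t) x‖ ≤ K * (-t) ^ (-(1 : ℝ)))
    (hE : ∀ n (x₀ : EuclideanSpace ℝ (Fin 3)) (t₀ r : ℝ), t₀ ≤ 0 → 0 < r →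
      r⁻¹ * ∫ t in Ioo (t₀ - r ^ 2) t₀, ∫ x in ball x₀ r, ‖fderiv ℝ (w n t) x‖ ^ 2 ≤ C)
    (x₀ : EuclideanSpace ℝ (Fin 3)) {t₀ r : ℝ} (ht₀ : t₀ < 0) (hr : 0 < r) :
    r⁻¹ * ∫ t in Ioo (t₀ - r ^ 2) t₀, ∫ x in ball x₀ r, ‖fderiv ℝ (W t) x‖ ^ 2 ≤ C := by
  -- `K ≥ 0` unless the sequence is empty of content; get it from `n = 0`
  have hK : 0 ≤ K := nonneg_of_gradient_bound (h1x 0)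
  set B : ℝ := (K * (-t₀) ^ (-(1 : ℝ))) ^ 2 with hB
  -- Step 1: convergence of the inner integrals for `t < t₀`
  have hin : ∀ t ∈ Ioo (t₀ - r ^ 2) t₀, Tendsto (fun n => ∫ x in ball x₀ r, ‖fderiv ℝ (w n t) x‖ ^ 2)
      atTop (𝓝 (∫ x in ball x₀ r, ‖fderiv ℝ (W t) x‖ ^ 2)) := by
    intro t ht
    have ht0 : t < 0 := ht.2.trans ht₀
    refine tendsto_integral_of_dominated_convergence (fun _ => B)
      (fun n => ((((hw n).contDiff_slice ht0).continuous_fderiv (by simp)).norm.pow 2).aestronglyMeasurable)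
      (integrableOn_const (measure_ball_lt_top).ne) (fun n => Eventually.of_forall fun x => ?_)
      (Eventually.of_forall fun x => ((hgrad t ht0 x).norm).pow 2)
    rw [Real.norm_eq_abs, abs_of_nonneg (sq_nonneg _), hB]
    exact pow_le_pow_left₀ (norm_nonneg _)
      ((h1x n t ht0 x).trans (gradient_bound_mono hK ht₀ ht.2.le)) 2
  -- Step 2: dominated convergence in `t`
  set B' : ℝ := B * (volume : Measure (EuclideanSpace ℝ (Fin 3))).real (ball x₀ r) with hB'
  have hout : Tendsto (fun n => ∫ t in Ioo (t₀ - r ^ 2) t₀, ∫ x in ball x₀ r, ‖fderiv ℝ (w n t) x‖ ^ 2)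
      atTop (𝓝 (∫ t in Ioo (t₀ - r ^ 2) t₀, ∫ x in ball x₀ r, ‖fderiv ℝ (W t) x‖ ^ 2)) := by
    refine tendsto_integral_of_dominated_convergence (fun _ => B') (fun n => ?_)
      (integrableOn_const (by rw [Real.volume_Ioo]; exact ENNReal.ofReal_ne_top))
      (fun n => ?_) ?_
    · exact (continuousOn_of_forall_continuousAt fun t ht =>
        continuousAt_enstrophy (hw n) (h1x n) x₀ r (ht.2.trans ht₀)).aestronglyMeasurable
        measurableSet_Ioo
    · filter_upwards [ae_restrict_mem measurableSet_Ioo] with t ht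
      rw [hB', hB]
      exact enstrophy_le (h1x n) x₀ r ht₀ ht.2.le
    · filter_upwards [ae_restrict_mem measurableSet_Ioo] with t ht
      exact hin t ht
  have _ := hW
  exact le_of_tendsto' (hout.const_mul r⁻¹) fun n => hE n x₀ t₀ r ht₀.le hr

/-- `(-r², 0)` is the increasing union of the intervals `(-r², -r²/(n+2))`. -/
theorem iUnion_Ioo_neg_sq {r : ℝ} (hr : 0 < r) :
    (⋃ n : ℕ, Ioo (-r ^ 2) (-(r ^ 2 / ((n : ℝ) + 2)))) = Ioo (-r ^ 2) 0 := by
  ext x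
  simp only [mem_iUnion, mem_Ioo]
  constructor
  · rintro ⟨n, h1, h2⟩
    exact ⟨h1, h2.trans (by rw [neg_lt_zero]; positivity)⟩
  · rintro ⟨h1, h2⟩
    obtain ⟨n, hn⟩ := exists_nat_gt (r ^ 2 / -x)
    refine ⟨n, h1, ?_⟩
    have hx : 0 < -x := neg_pos.2 h2
    have hn2 : r ^ 2 / -x < (n : ℝ) + 2 := hn.trans (by linarith)
    rw [div_lt_iff₀ hx] at hn2
    rw [lt_neg, div_lt_iff₀ (by positivity)]
    linarith

/-- **The scaled dissipation of the limit on cylinders touching `t = 0`.** If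
`r⁻¹∫_{(b-r²,b)}∫_{B(x₀,r)}‖∇W‖² ≤ C` for every negative top `b < 0`, then also for `b = 0`
(monotone convergence along `(-r², -r²/(n+2)) ↑ (-r², 0)`, each piece inside a cylinder with
negative top; if the integrand is not integrable on `(-r², 0)` the Bochner integral vanishes). -/
theorem energyE_of_limit_zero (hW : IsTypeIAncientMild C W)
    (h1xW : ∀ t < 0, ∀ x, ‖fderiv ℝ (W t) x‖ ≤ K * (-t) ^ (-(1 : ℝ)))
    (hneg : ∀ (x₀ : EuclideanSpace ℝ (Fin 3)) (b r : ℝ), b < 0 → 0 < r →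
      r⁻¹ * ∫ t in Ioo (b - r ^ 2) b, ∫ x in ball x₀ r, ‖fderiv ℝ (W t) x‖ ^ 2 ≤ C)
    (x₀ : EuclideanSpace ℝ (Fin 3)) {r : ℝ} (hr : 0 < r) :
    r⁻¹ * ∫ t in Ioo (0 - r ^ 2) 0, ∫ x in ball x₀ r, ‖fderiv ℝ (W t) x‖ ^ 2 ≤ C := by
  have hC : 0 ≤ C := hW.nonneg
  set G : ℝ → ℝ := fun t => ∫ x in ball x₀ r, ‖fderiv ℝ (W t) x‖ ^ 2 with hG
  rw [zero_sub]
  by_cases hint : IntegrableOn G (Ioo (-r ^ 2) 0) volume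
  · -- monotone convergence along the pieces
    set s : ℕ → Set ℝ := fun n => Ioo (-r ^ 2) (-(r ^ 2 / ((n : ℝ) + 2))) with hs
    have hmono : Monotone s := by
      intro m n hmn x hx
      refine ⟨hx.1, hx.2.trans_le ?_⟩
      have : (r ^ 2 / ((n : ℝ) + 2)) ≤ r ^ 2 / ((m : ℝ) + 2) :=
        div_le_div_of_nonneg_left (sq_nonneg r) (by positivity) (by exact_mod_cast (by linarith))
      linarith
    have hU : (⋃ n, s n) = Ioo (-r ^ 2) 0 := iUnion_Ioo_neg_sq hr
    have hlim : Tendsto (fun n => ∫ t in s n, G t) atTop (𝓝 (∫ t in Ioo (-r ^ 2) 0, G t)) := by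
      rw [← hU]
      refine tendsto_setIntegral_of_monotone (fun n => measurableSet_Ioo) hmono ?_
      rwa [hU]
    -- each piece is dominated by a cylinder with negative top `b = -r²/(n+2)`
    have hpiece : ∀ n, ∫ t in s n, G t ≤ r * C := by
      intro n
      set b : ℝ := -(r ^ 2 / ((n : ℝ) + 2)) with hb
      have hb0 : b < 0 := by rw [hb, neg_lt_zero]; positivity
      have hsub : s n ⊆ Ioo (b - r ^ 2) b := fun x hx => ⟨by linarith [hx.1], hx.2⟩
      have hGint : IntegrableOn G (Ioo (b - r ^ 2) b) volume := by
        have hmeas : AEStronglyMeasurable G (volume.restrict (Ioo (b - r ^ 2) b)) :=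
          (continuousOn_of_forall_continuousAt fun t ht =>
            continuousAt_enstrophy hW h1xW x₀ r (ht.2.trans hb0)).aestronglyMeasurable
            measurableSet_Ioo
        refine Integrable.mono' (integrableOn_const (C := (K * (-b) ^ (-(1 : ℝ))) ^ 2 *
          (volume : Measure (EuclideanSpace ℝ (Fin 3))).real (ball x₀ r))
          (by rw [Real.volume_Ioo]; exact ENNReal.ofReal_ne_top)) hmeas ?_
        filter_upwards [ae_restrict_mem measurableSet_Ioo] with t ht
        exact enstrophy_le h1xW x₀ r hb0 ht.2.le
      have hGnn : 0 ≤ᵐ[volume.restrict (Ioo (b - r ^ 2) b)] G :=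
        Eventually.of_forall fun t => integral_nonneg fun x => sq_nonneg _
      have h1 : ∫ t in s n, G t ≤ ∫ t in Ioo (b - r ^ 2) b, G t :=
        setIntegral_mono_set hGint hGnn (Eventually.of_forall hsub)
      have h2 : r⁻¹ * ∫ t in Ioo (b - r ^ 2) b, G t ≤ C := hneg x₀ b r hb0 hr
      rw [inv_mul_le_iff₀ hr] at h2
      exact h1.trans h2
    have hle : ∫ t in Ioo (-r ^ 2) 0, G t ≤ r * C := le_of_tendsto' hlim hpiece
    rw [inv_mul_le_iff₀ hr]
    exact hle
  · rw [integral_undef hint, mul_zero]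
    exact hC

/-- **The local-energy clause passes to the limit** (registered sub-goal material of
`stub_zoomCompactness`): along `wₙ → W` (fields and gradients pointwise, Type-I ancient mild with
one constant `C`, uniform gradient bound `K(-t)⁻¹`), the bounds `A, E ≤ C` on all parabolic
cylinders below `t = 0` for every `wₙ` give the same bounds for `W`. -/
theorem localEnergy_of_limit (hw : ∀ n, IsTypeIAncientMild C (w n)) (hW : IsTypeIAncientMild C W)
    (hpt : ∀ t < 0, ∀ x, Tendsto (fun n => w n t x) atTop (𝓝 (W t x)))
    (hgrad : ∀ t < 0, ∀ x, Tendsto (fun n => fderiv ℝ (w n t) x) atTop (𝓝 (fderiv ℝ (W t) x)))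
    (h1x : ∀ n, ∀ t < 0, ∀ x, ‖fderiv ℝ (w n t) x‖ ≤ K * (-t) ^ (-(1 : ℝ)))
    (hLE : ∀ n (x₀ : EuclideanSpace ℝ (Fin 3)) (t₀ r : ℝ), t₀ ≤ 0 → 0 < r →
      (∀ t, t₀ - r ^ 2 < t → t < t₀ → r⁻¹ * ∫ x in ball x₀ r, ‖w n t x‖ ^ 2 ≤ C) ∧
        r⁻¹ * ∫ t in Ioo (t₀ - r ^ 2) t₀, ∫ x in ball x₀ r, ‖fderiv ℝ (w n t) x‖ ^ 2 ≤ C) :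
    ∀ (x₀ : EuclideanSpace ℝ (Fin 3)) (t₀ r : ℝ), t₀ ≤ 0 → 0 < r →
      (∀ t, t₀ - r ^ 2 < t → t < t₀ → r⁻¹ * ∫ x in ball x₀ r, ‖W t x‖ ^ 2 ≤ C) ∧
        r⁻¹ * ∫ t in Ioo (t₀ - r ^ 2) t₀, ∫ x in ball x₀ r, ‖fderiv ℝ (W t) x‖ ^ 2 ≤ C := by
  -- the gradient bound of the limit
  have h1xW : ∀ t < 0, ∀ x, ‖fderiv ℝ (W t) x‖ ≤ K * (-t) ^ (-(1 : ℝ)) := fun t ht x =>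
    le_of_tendsto (hgrad t ht x).norm (Eventually.of_forall fun n => h1x n t ht x)
  have hneg : ∀ (x₀ : EuclideanSpace ℝ (Fin 3)) (b r : ℝ), b < 0 → 0 < r →
      r⁻¹ * ∫ t in Ioo (b - r ^ 2) b, ∫ x in ball x₀ r, ‖fderiv ℝ (W t) x‖ ^ 2 ≤ C :=
    fun x₀ b r hb hr => energyE_of_limit_neg hw hW hgrad h1x (fun n x₀ t₀ r ht₀ hr =>
      (hLE n x₀ t₀ r ht₀ hr).2) x₀ hb hr
  intro x₀ t₀ r ht₀ hr
  refine ⟨fun t h1 h2 => energyA_of_limit hw hW hpt (fun n x₀ t₀ r ht₀ hr => (hLE n x₀ t₀ r ht₀ hr).1)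
    x₀ ht₀ hr h1 h2, ?_⟩
  rcases lt_or_eq_of_le ht₀ with h | h
  · exact hneg x₀ t₀ r h hr
  · subst h
    exact energyE_of_limit_zero hW h1xW hneg x₀ hr


/-- **The local-energy clause passes to the limit** (registered sub-goal `zoomEnergy_of_limit`
of `stub_zoomCompactness`; closed form of `localEnergy_of_limit`). -/
theorem zoomEnergy_of_limit :
    ∀ (C K : ℝ) (w : ℕ → ℝ → EuclideanSpace ℝ (Fin 3) → EuclideanSpace ℝ (Fin 3)) (W : ℝ → EuclideanSpace ℝ (Fin 3) → EuclideanSpace ℝ (Fin 3)), (∀ n, Literature.Analysis.FluidPDE.IsTypeIAncientMild C (w n)) → Literature.Analysis.FluidPDE.IsTypeIAncientMild C W → (∀ t : ℝ, t < 0 → ∀ x, Filter.Tendsto (fun n => w n t x) Filter.atTop (nhds (W t x))) → (∀ t : ℝ, t < 0 → ∀ x, Filter.Tendsto (fun n => fderiv ℝ (w n t) x) Filter.atTop (nhds (fderiv ℝ (W t) x))) → (∀ n, ∀ t : ℝ, t < 0 → ∀ x, ‖fderiv ℝ (w n t) x‖ ≤ K * (-t) ^ (-(1 : ℝ))) → (∀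 n (x₀ : EuclideanSpace ℝ (Fin 3)) (t₀ r : ℝ), t₀ ≤ 0 → 0 < r → (∀ t, t₀ - r ^ 2 < t → t < t₀ → r⁻¹ * ∫ x in Metric.ball x₀ r, ‖w n t x‖ ^ 2 ≤ C) ∧ r⁻¹ * ∫ t in Set.Ioo (t₀ - r ^ 2) t₀, ∫ x in Metric.ball x₀ r, ‖fderiv ℝ (w n t) x‖ ^ 2 ≤ C) → ∀ (x₀ : EuclideanSpace ℝ (Fin 3)) (t₀ r : ℝ), t₀ ≤ 0 → 0 < r → (∀ t, t₀ - r ^ 2 < t → t < t₀ → r⁻¹ * ∫ x in Metric.ball x₀ r, ‖W t x‖ ^ 2 ≤ C) ∧ r⁻¹ * ∫ t in Set.Ioo (t₀ - r ^ 2) t₀, ∫ x in Metric.ball x₀ r, ‖fderiv ℝ (W t) x‖ ^ 2 ≤ C :=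
  fun _ _ _ _ hw hW hpt hgrad h1x hLE => localEnergy_of_limit hw hW hpt hgrad h1x hLE

end Energy

end Summit.NavierStokesRegularity.NavierStokesRegularity.Theorems

end
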